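import Literature.Probability.Percolation.OneArmLowerBound
import Literature.Probability.Percolation.OneArmNeumannCoupling
import HarnessLib

/-!
# `0 ∉ Q` almost surely at subsequential scaling limits (proofs only)

Topic `Probability/Percolation`; family `crit-perc`. Def-free, fact-free sequel of
`OneArmSubsequentialLimits.lean`, `OneArmLowerBound.lean` and `OneArmNeumannCoupling.lean`.
Lawler–Schramm–Werner, *One-arm exponent for critical 2D percolation*, Electron. J. Probab. **7**
(2002), paper no. 2, p. 4: "It follows from Theorem 2.1 or from the Russo-Seymour-Welsh Theorem
that `0 ∉ Q(θ)` a.s." — so that the conformal radius `𝔯(θ)` of the component of `0` in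
`𝕌 ∖ Q(θ)` is positive. For the weak limits `ν` of the hull laws `lswLaw (R_k)`, `R_k → ∞`, on
the Hausdorff space this is the hypothesis "`𝔯 > 0` `ν`-a.s." of
`renewal_hypotheses_of_arcCoupling` / `oneArm_exponent_of_subseqArcCoupling`; this file proves it
by the RSW route, from the annulus lemma of Bollobás–Riordan (Ch. 7, Lemma 4; PROVED in the tree,
`tri_annulusCrossing_bound_holds`):

* `exists_lswLaw_meetsBall_le_rpow` — there is `α > 0` with
  `P[Q_{1/R} ∈ meetsBall r] = P_{1/2}[C(rR, R)] ≤ r^α` for `0 < r ≤ 1/2`, `R ≥ 1000/r`;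
* `measureReal_meetsClosedBall_le_rpow_of_subseqLimit` — hence at every weak limit `ν` of
  `lswLaw (R_k)`, `R_k → ∞`: `ν(meetsClosedBall (r/2)) ≤ r^α` (portmanteau for the closed set
  `{dist(0, K) ≤ r/2} ⊆ {dist(0, K) < r}`);
* `measure_setOf_zero_mem_eq_zero_of_subseqLimit`, `ae_conformalRadius_pos_of_subseqLimit` —
  so `ν{K | 0 ∈ K} = 0`, i.e. `𝔯(K) > 0` for `ν`-a.e. `K` (`conformalRadius_pos_iff_zero_notMem`);
* `oneArm_exponent_of_subseqArcCoupling'` — `oneArm_exponent_of_subseqArcCoupling` with this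
  hypothesis discharged: the three LSW facts (`LawlerSchrammWerner2002_hittingPDE`,
  `LawlerSchrammWerner2002_scalingLimitExponent`, `oneArm_exponent`) follow from the existence, at
  every subsequential weak limit, of arc couplings with LSW's (2.10) and the tail (2.14) alone.

No new definitions, no named facts.

## References

* G. F. Lawler, O. Schramm, W. Werner, *One-arm exponent for critical 2D percolation*, Electron.
  J. Probab. 7 (2002), no. 2, §2 (p. 4), §3 (p. 8) [LawlerSchrammWernerEJP2002].
* B. Bollobás, O. Riordan, *Percolation*, Cambridge University Press (2006), Ch. 7, Lemma 4
  (p. 166) [BollobasRiordan2006].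
* P. Billingsley, *Convergence of Probability Measures*, 2nd ed. (1999), Thm. 2.1
  [Billingsley1999].

## Mathlib / tree

Tree: `tri_annulusCrossing_bound_holds` (`TriAnnulusCrossingProofs`), `real_triOpenCrossing_eq`,
`isClosed_meetsClosedBall`, `meetsClosedBall_subset_meetsBall` (`OneArmScalingLimit`),
`conformalRadius_pos_iff_zero_notMem`, `oneArm_exponent_of_subseqArcCoupling`
(`OneArmNeumannCoupling`). Mathlib: `ProbabilityMeasure.limsup_measure_closed_le_of_tendsto`,
`le_of_forall_pos_le_add`-type limits, `measure_mono_null`.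
-/

noncomputable section

open MeasureTheory Filter Topology Set Metric TopologicalSpace
open Literature.Probability.LatticeModels Literature.Analysis.Complex
  Literature.Probability.RandomPlanarGeometry Literature.Probability.RandomPlanarGeometry.RadialLoewner
open scoped ENNReal NNReal

namespace Literature.Probability.Percolation

/-- **RSW one-arm decay for the hull laws**: there is `α > 0` such that for `0 < r ≤ 1/2` and
`R ≥ 1000/r`, `P[Q_{1/R} ∈ meetsBall r] = P_{1/2}[C(rR, R)] ≤ r^α` (the annulus lemma
`tri_annulusCrossing_bound_holds` at mesh `1`, centre `0`, radii `rR ≥ 1000`, `R ≥ 2rR`).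
[cite: BollobasRiordan2006, Ch. 7 Lemma 4 (p. 166)] [cite: LawlerSchrammWernerEJP2002, §3 (p. 8)] -/
theorem exists_lswLaw_meetsBall_le_rpow :
    ∃ α : ℝ, 0 < α ∧ ∀ r : ℝ, 0 < r → r ≤ 1 / 2 → ∀ R : ℝ, 1000 / r ≤ R →
      ((lswLaw R : Measure (NonemptyCompacts ℂ)) (meetsBall r)).toReal ≤ r ^ α := by
  obtain ⟨α, hα, hb⟩ := tri_annulusCrossing_bound_holds
  refine ⟨α, hα, fun r hr0 hr2 R hR ↦ ?_⟩
  have hRpos : 0 < R := lt_of_lt_of_le (by positivity) hR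
  have h1 : 1000 * (1 : ℝ) ≤ r * R := by
    rw [div_le_iff₀ hr0] at hR; linarith
  have h2 : 2 * (r * R) ≤ R := by nlinarith
  have h := hb true 1 0 (r * R) R one_pos h1 h2
  rw [show r * R / R = r by field_simp] at h
  rwa [← real_triOpenCrossing_eq (by linarith) hRpos]

/-- **At subsequential limits, `ν(meetsClosedBall (r/2)) ≤ r^α`** for `0 < r ≤ 1/2`, along any
`R_k → ∞` with `lswLaw (R_k) → ν`: portmanteau for the closed set `meetsClosedBall (r/2)`, contained
in the open `meetsBall r` whose probability is eventually `≤ r^α`.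
[cite: LawlerSchrammWernerEJP2002, §2 (p. 4)] [cite: Billingsley1999, Thm. 2.1] -/
theorem measureReal_meetsClosedBall_le_rpow_of_subseqLimit :
    ∃ α : ℝ, 0 < α ∧ ∀ (R : ℕ → ℝ) (ν : ProbabilityMeasure (NonemptyCompacts ℂ)),
      Tendsto R atTop atTop → Tendsto (lswLaw ∘ R) atTop (𝓝 ν) →
      ∀ r : ℝ, 0 < r → r ≤ 1 / 2 →
        (ν : Measure (NonemptyCompacts ℂ)).real (meetsClosedBall (r / 2)) ≤ r ^ α := by
  obtain ⟨α, hα, hb⟩ := exists_lswLaw_meetsBall_le_rpow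
  refine ⟨α, hα, fun R ν hR hν r hr0 hr2 ↦ ?_⟩
  have hport : limsup (fun k ↦ ((lswLaw ∘ R) k : Measure (NonemptyCompacts ℂ)) (meetsClosedBall (r / 2))) atTop ≤
      (ν : Measure (NonemptyCompacts ℂ)) (meetsClosedBall (r / 2)) :=
    ProbabilityMeasure.limsup_measure_closed_le_of_tendsto hν (isClosed_meetsClosedBall (r / 2))
  -- we need the reverse: `ν(closed) ≤ ...`; use the open set `meetsBall r ⊇ meetsClosedBall (r/2)`
  have hopen : (ν : Measure (NonemptyCompacts ℂ)) (meetsBall r) ≤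
      liminf (fun k ↦ ((lswLaw ∘ R) k : Measure (NonemptyCompacts ℂ)) (meetsBall r)) atTop :=
    ProbabilityMeasure.le_liminf_measure_open_of_tendsto hν (isOpen_meetsBall r)
  have hev : ∀ᶠ k in atTop, ((lswLaw ∘ R) k : Measure (NonemptyCompacts ℂ)) (meetsBall r) ≤ ENNReal.ofReal (r ^ α) := by
    filter_upwards [hR.eventually_ge_atTop (1000 / r)] with k hk
    have h := hb r hr0 hr2 (R k) hk
    rw [Function.comp_apply, ← ENNReal.ofReal_toReal (measure_ne_top _ (meetsBall r))]
    exact ENNReal.ofReal_le_ofReal h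
  have hlim : liminf (fun k ↦ ((lswLaw ∘ R) k : Measure (NonemptyCompacts ℂ)) (meetsBall r)) atTop ≤
      ENNReal.ofReal (r ^ α) :=
    liminf_le_of_frequently_le hev.frequently (by isBoundedDefault)
  have hsub : meetsClosedBall (r / 2) ⊆ meetsBall r := meetsClosedBall_subset_meetsBall (by linarith)
  have hν : (ν : Measure (NonemptyCompacts ℂ)) (meetsClosedBall (r / 2)) ≤ ENNReal.ofReal (r ^ α) :=
    ((measure_mono hsub).trans hopen).trans hlim
  rw [Measure.real, ← ENNReal.toReal_ofReal (Real.rpow_nonneg hr0.le α)]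
  exact ENNReal.toReal_mono ENNReal.ofReal_ne_top hν

/-- **`ν{K | 0 ∈ K} = 0` at subsequential limits** ("`0 ∉ Q` a.s.", LSW p. 4, by RSW): for every
`r ∈ (0, 1/2]`, `{0 ∈ K} ⊆ meetsClosedBall (r/2)` has `ν`-probability `≤ r^α → 0`.
[cite: LawlerSchrammWernerEJP2002, §2 (p. 4)] -/
theorem measure_setOf_zero_mem_eq_zero_of_subseqLimit (R : ℕ → ℝ) (ν : ProbabilityMeasure (NonemptyCompacts ℂ))
    (hR : Tendsto R atTop atTop) (hν : Tendsto (lswLaw ∘ R) atTop (𝓝 ν)) :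
    (ν : Measure (NonemptyCompacts ℂ)) {K | (0 : ℂ) ∈ (K : Set ℂ)} = 0 := by
  obtain ⟨α, hα, hb⟩ := measureReal_meetsClosedBall_le_rpow_of_subseqLimit
  have hsub : ∀ s : ℝ, 0 ≤ s → {K : NonemptyCompacts ℂ | (0 : ℂ) ∈ (K : Set ℂ)} ⊆ meetsClosedBall s := by
    intro s hs K hK
    have hK' : (0 : ℂ) ∈ (K : Set ℂ) := hK
    show infDist (0 : ℂ) (K : Set ℂ) ≤ s
    rw [infDist_zero_of_mem hK']
    exact hs
  -- `ν.real {0 ∈ K} ≤ r^α` for all small `r > 0`, hence `= 0`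
  have hle : ∀ r : ℝ, 0 < r → r ≤ 1 / 2 →
      (ν : Measure (NonemptyCompacts ℂ)).real {K | (0 : ℂ) ∈ (K : Set ℂ)} ≤ r ^ α := fun r hr0 hr2 ↦
    (measureReal_mono (hsub (r / 2) (by linarith))).trans (hb R ν hR hν r hr0 hr2)
  have hzero : (ν : Measure (NonemptyCompacts ℂ)).real {K | (0 : ℂ) ∈ (K : Set ℂ)} = 0 := by
    refine le_antisymm ?_ measureReal_nonneg
    -- `r^α → 0` as `r → 0⁺`
    have htend : Tendsto (fun r : ℝ ↦ r ^ α) (𝓝[>] 0) (𝓝 0) := by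
      have := (Real.continuousAt_rpow_const 0 α (Or.inr hα.le)).tendsto
      rw [Real.zero_rpow hα.ne'] at this
      exact this.mono_left nhdsWithin_le_nhds
    have hev : ∀ᶠ r in 𝓝[>] (0 : ℝ), (ν : Measure (NonemptyCompacts ℂ)).real {K | (0 : ℂ) ∈ (K : Set ℂ)} ≤ r ^ α := by
      have hmem : Ioo (0 : ℝ) (1 / 2) ∈ 𝓝[>] (0 : ℝ) := Ioo_mem_nhdsGT (by norm_num)
      filter_upwards [hmem] with r hr
      exact hle r hr.1 hr.2.le
    exact ge_of_tendsto htend hev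
  rw [← measureReal_eq_zero_iff]
  exact hzero

/-- **`𝔯(K) > 0` for `ν`-a.e. `K` at subsequential limits** (`0 ∉ K` a.s. and
`conformalRadius_pos_iff_zero_notMem`). [cite: LawlerSchrammWernerEJP2002, §2 (p. 4)] -/
theorem ae_conformalRadius_pos_of_subseqLimit (R : ℕ → ℝ) (ν : ProbabilityMeasure (NonemptyCompacts ℂ))
    (hR : Tendsto R atTop atTop) (hν : Tendsto (lswLaw ∘ R) atTop (𝓝 ν)) :
    ∀ᵐ K ∂(ν : Measure (NonemptyCompacts ℂ)), 0 < conformalRadius ((K : NonemptyCompacts ℂ) : Set ℂ) := by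
  rw [ae_iff]
  have hset : {K : NonemptyCompacts ℂ | ¬ 0 < conformalRadius ((K : NonemptyCompacts ℂ) : Set ℂ)} =
      {K : NonemptyCompacts ℂ | (0 : ℂ) ∈ (K : Set ℂ)} := by
    ext K
    simp only [mem_setOf_eq, conformalRadius_pos_iff_zero_notMem, not_not]
  rw [hset]
  exact measure_setOf_zero_mem_eq_zero_of_subseqLimit R ν hR hν

/-- **The three LSW facts from arc couplings with (2.10) and the tail (2.14) alone**
(`oneArm_exponent_of_subseqArcCoupling` with the positivity of `𝔯` discharged by
`ae_conformalRadius_pos_of_subseqLimit`): if every weak limit `ν` of `lswLaw (R_k)`, `R_k → ∞`,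
admits for `θ ∈ (0, 2π)` couplings `μ_θ` of `(K_θ, K_{2π})` with second marginal `ν`,
`K_θ ⊆ K_{2π}` a.s., LSW's (2.10) for the first marginal and the tail
`μ_θ{K_{2π} ⊄ K_θ ∪ B̄(1, r)} ≤ c ((2π - θ)/r)^γ` (`γ > 1`, `θ` near `2π`, `r > 0`), then
`LawlerSchrammWerner2002_hittingPDE`, `LawlerSchrammWerner2002_scalingLimitExponent` and
`oneArm_exponent` hold. [cite: LawlerSchrammWernerEJP2002, Thm. 1.1, Thm. 1.2, §2 (Thm. 2.1, (2.10), Lemma 2.3)] -/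
theorem oneArm_exponent_of_subseqArcCoupling'
    (h : ∀ (R : ℕ → ℝ) (ν : ProbabilityMeasure (NonemptyCompacts ℂ)),
      Tendsto R atTop atTop → Tendsto (lswLaw ∘ R) atTop (𝓝 ν) →
      ∃ μ : ℝ → ProbabilityMeasure (NonemptyCompacts ℂ × NonemptyCompacts ℂ),
        (∀ θ ∈ Ioo 0 (2 * Real.pi),
          (μ θ : Measure (NonemptyCompacts ℂ × NonemptyCompacts ℂ)).map Prod.snd = ν) ∧
        (∀ θ ∈ Ioo 0 (2 * Real.pi), ∀ᵐ p ∂(μ θ : Measure (NonemptyCompacts ℂ × NonemptyCompacts ℂ)),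
          ((p.1 : NonemptyCompacts ℂ) : Set ℂ) ⊆ (p.2 : Set ℂ)) ∧
        (∀ θ ∈ Ioo 0 (2 * Real.pi), ∀ s : ℝ,
          (μ θ : Measure (NonemptyCompacts ℂ × NonemptyCompacts ℂ)).real
              {p | conformalRadius ((p.1 : NonemptyCompacts ℂ) : Set ℂ) ≤ Real.exp (-s)} =
            renewalST 6 bottomDatum (fun s ↦ (ν : Measure (NonemptyCompacts ℂ)).real
              {K | conformalRadius (K : Set ℂ) ≤ Real.exp (-s)}) θ s) ∧
        ∃ θ₁ c γ : ℝ, θ₁ < 2 * Real.pi ∧ 1 < γ ∧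
          ∀ θ ∈ Ioo θ₁ (2 * Real.pi), ∀ r : ℝ, 0 < r →
            (μ θ : Measure (NonemptyCompacts ℂ × NonemptyCompacts ℂ)).real
                {p | ¬ (((p.2 : NonemptyCompacts ℂ) : Set ℂ) ⊆ (p.1 : Set ℂ) ∪ closedBall (1 : ℂ) r)} ≤
              c * ((2 * Real.pi - θ) / r) ^ γ) :
    LawlerSchrammWerner2002_hittingPDE ∧ LawlerSchrammWerner2002_scalingLimitExponent ∧ oneArm_exponent :=
  oneArm_exponent_of_subseqArcCoupling fun R ν hR hν ↦
    ⟨ae_conformalRadius_pos_of_subseqLimit R ν hR hν, h R ν hR hν⟩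

end Literature.Probability.Percolation
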